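import Literature.Topology.FourManifolds.SweepData
import Literature.Topology.FourManifolds.CreaseNormalFormConstruction
import Literature.Topology.FourManifolds.FacetFrame
import Literature.Topology.FourManifolds.CellTriangulation
import HarnessLib

/-!
# Stage 1 of the sweep, per cell: the crease normal form of a codimension-one cell

Topic `Literature/Topology/FourManifolds`; instantiation of
`CreaseNormalFormConstruction.exists_creaseNormalForm` from the data of a good triangulation
(`SweepData n M c₁ c₂`) at a codimension-one cell `c` (Munkres, Ann. of Math. 72 (1960), §§2–3).
The result is packaged in the structure `SweepData.FacetChart S c m` (the margin `m > 0` says how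
deep into the cell the crease will be smoothed): an affine basis `β` of `ℝⁿ` extending the
simplex of `c` with apex index `i₀` (`facet β i₀ = S.simplex c`), a base index `j₀ ≠ i₀`, the
two top cofaces `insert p± (S.simplex c)` of the owner complex (`CofacePair.exists_coface_of_sign`
at the centroid), their `C^∞` models `fu, fl` (first structure) and `ku, kl` (second structure),
and the crease normal form `Θ, Θ', Glow, δ` of the transition `e₂ ∘ e₁.symm` over the open core
`facetCoreOpen β i₀ j₀ m`, with the smoothness of `Θ^{±1}`, `Θ'^{±1}` and the formulas
`Θ = fu ∘ A`, `Θ' = ku ∘ A` (`A p = β j₀ + facetFrame β hj p`).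

`SweepData.nonempty_facetChart` proves the structure is inhabited for `n ≥ 1`, every
codimension-one cell and every `m > 0`.  Everything is proved; no named facts.

## References

* J. R. Munkres, *Obstructions to the smoothing of piecewise-differentiable homeomorphisms*, Ann.
  of Math. (2) 72 (1960), 521–554, §§2–3. [Munkres1960]
-/

noncomputable section

open Set Function Metric Filter
open scoped Topology Manifold ContDiff

namespace Literature.Topology.FourManifolds

universe u

/-- Local notation: `𝔼 n` is the model Euclidean space `EuclideanSpace ℝ (Fin n)`. -/
local notation "𝔼 " n:arg => EuclideanSpace ℝ (Fin n)

/-- The index type of affine bases of `ℝⁿ` produced by `exists_affineBasis_superset`.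
[folklore] -/
abbrev FIdx (n : ℕ) : Type := Fin (Module.finrank ℝ (𝔼 n) + 1)

variable {n : ℕ} {M : Type u} [TopologicalSpace M] {c₁ c₂ : ChartedSpace (𝔼 n) M}

namespace SweepData

variable (S : SweepData n M c₁ c₂)

/-- **Per-facet MODEL data** (margin-free): an affine basis extending the simplex of `c`, the two
top cofaces, and `C^∞` models of the two PD charts on them. [folklore] -/
structure FacetModel (c : S.κ) where
  /-- affine basis extending the simplex of `c` -/
  β : AffineBasis (FIdx n) ℝ (𝔼 n)
  /-- the apex index -/
  i₀ : FIdx n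
  /-- a base index of the facet -/
  j₀ : FIdx n
  hj : j₀ ≠ i₀
  facet_eq : facet β i₀ = S.simplex c
  /-- the upper apex -/
  pu : 𝔼 n
  /-- the lower apex -/
  pl : 𝔼 n
  hpu : 0 < β.coord i₀ pu
  hpl : β.coord i₀ pl < 0
  tu_mem : insert pu (S.simplex c) ∈ (S.K (S.owner c)).faces
  tl_mem : insert pl (S.simplex c) ∈ (S.K (S.owner c)).faces
  /-- models of the first PD chart on the two cofaces -/
  fu : 𝔼 n → 𝔼 n
  fl : 𝔼 n → 𝔼 n
  /-- models of the second PD chart on the two cofaces -/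
  ku : 𝔼 n → 𝔼 n
  kl : 𝔼 n → 𝔼 n
  hfu : ContDiff ℝ ∞ fu
  hfl : ContDiff ℝ ∞ fl
  hku : ContDiff ℝ ∞ ku
  hkl : ContDiff ℝ ∞ kl
  fu_eq : EqOn (S.e₁ (S.owner c) ∘ (S.φ (S.owner c)).symm) fu
    (convexHull ℝ ((insert pu (S.simplex c) : Finset (𝔼 n)) : Set (𝔼 n)))
  fl_eq : EqOn (S.e₁ (S.owner c) ∘ (S.φ (S.owner c)).symm) fl
    (convexHull ℝ ((insert pl (S.simplex c) : Finset (𝔼 n)) : Set (𝔼 n)))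
  ku_eq : EqOn (S.e₂ (S.owner c) ∘ (S.φ (S.owner c)).symm) ku
    (convexHull ℝ ((insert pu (S.simplex c) : Finset (𝔼 n)) : Set (𝔼 n)))
  kl_eq : EqOn (S.e₂ (S.owner c) ∘ (S.φ (S.owner c)).symm) kl
    (convexHull ℝ ((insert pl (S.simplex c) : Finset (𝔼 n)) : Set (𝔼 n)))
  hDfu : ∀ x ∈ convexHull ℝ ((insert pu (S.simplex c) : Finset (𝔼 n)) : Set (𝔼 n)),
    Injective (fderiv ℝ fu x)
  hDfl : ∀ x ∈ convexHull ℝ ((insert pl (S.simplex c) : Finset (𝔼 n)) : Set (𝔼 n)),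
    Injective (fderiv ℝ fl x)
  hDku : ∀ x ∈ convexHull ℝ ((insert pu (S.simplex c) : Finset (𝔼 n)) : Set (𝔼 n)),
    Injective (fderiv ℝ ku x)
  hDkl : ∀ x ∈ convexHull ℝ ((insert pl (S.simplex c) : Finset (𝔼 n)) : Set (𝔼 n)),
    Injective (fderiv ℝ kl x)

namespace FacetModel

variable {S} {c : S.κ} (fm : S.FacetModel c)

/-- **The normal form of margin `m`** built on a facet model: the charts `Θ = fu ∘ A`,
`Θ' = ku ∘ A` (`A p = β j₀ + facetFrame β hj p`), the lower model, the width, the crease normal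
form of `e₂ ∘ e₁.symm` over `facetCoreOpen β i₀ j₀ m`, smoothness, and the location facts.
[folklore] -/
structure NF (m : ℝ) where
  /-- the charts of the normal form -/
  Θ : OpenPartialHomeomorph (facetDir fm.β fm.i₀ × ℝ) (𝔼 n)
  Θ' : OpenPartialHomeomorph (facetDir fm.β fm.i₀ × ℝ) (𝔼 n)
  /-- the lower model -/
  Glow : facetDir fm.β fm.i₀ × ℝ → facetDir fm.β fm.i₀ × ℝ
  /-- the width -/
  δ : ℝ
  normalForm : IsCreaseNormalForm Θ Θ' (S.e₂ (S.owner c) ∘ (S.e₁ (S.owner c)).symm) Glow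
    (facetCoreOpen fm.β fm.i₀ fm.j₀ m) δ
  hΘ : ContDiffOn ℝ ∞ Θ Θ.source
  hΘs : ContDiffOn ℝ ∞ Θ.symm Θ.target
  hΘ' : ContDiffOn ℝ ∞ Θ' Θ'.source
  hΘ's : ContDiffOn ℝ ∞ Θ'.symm Θ'.target
  Θ_apply : ∀ p, Θ p = fm.fu (fm.β fm.j₀ + facetFrame fm.β fm.hj p)
  Θ'_apply : ∀ p, Θ' p = fm.ku (fm.β fm.j₀ + facetFrame fm.β fm.hj p)
  box_mem : ∀ p : facetDir fm.β fm.i₀ × ℝ, p.1 ∈ facetCore fm.β fm.i₀ fm.j₀ (m / 2) → |p.2| < δ →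
    fm.β fm.j₀ + facetFrame fm.β fm.hj p ∈ (S.φ (S.owner c)).target ∩
      (S.φ (S.owner c)).symm ⁻¹' ((S.e₁ (S.owner c)).source ∩ (S.e₂ (S.owner c)).source) ∧
    ∃ q ∈ (S.φ (S.owner c)).target ∩
      (S.φ (S.owner c)).symm ⁻¹' ((S.e₁ (S.owner c)).source ∩ (S.e₂ (S.owner c)).source),
      (q ∈ convexHull ℝ ((insert fm.pu (S.simplex c) : Finset (𝔼 n)) : Set (𝔼 n)) ∨
        q ∈ convexHull ℝ ((insert fm.pl (S.simplex c) : Finset (𝔼 n)) : Set (𝔼 n))) ∧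
      S.e₁ (S.owner c) ((S.φ (S.owner c)).symm q) = fm.fu (fm.β fm.j₀ + facetFrame fm.β fm.hj p)
  upper_mem : ∀ p : facetDir fm.β fm.i₀ × ℝ, p.1 ∈ facetCore fm.β fm.i₀ fm.j₀ (m / 2) → 0 ≤ p.2 → p.2 < δ →
    fm.β fm.j₀ + facetFrame fm.β fm.hj p ∈ convexHull ℝ ((insert fm.pu (S.simplex c) : Finset (𝔼 n)) : Set (𝔼 n))
  box_source : ∀ p : facetDir fm.β fm.i₀ × ℝ, p.1 ∈ facetCore fm.β fm.i₀ fm.j₀ (m / 2) → |p.2| < δ →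
    p ∈ Θ.source ∧ p ∈ Θ'.source
  /-- the face formula of `DGlow (x, 0)` over the closed core of margin `m/2` (margin-free) -/
  glow_face : ∀ x ∈ facetCore fm.β fm.i₀ fm.j₀ (m / 2), ∃ L₁ L₂ L₃ L₄ : (𝔼 n) ≃L[ℝ] 𝔼 n,
    (L₁ : (𝔼 n) →L[ℝ] 𝔼 n) = fderiv ℝ fm.fu (fm.β fm.j₀ + facetFrame fm.β fm.hj (x, 0)) ∧
    (L₂ : (𝔼 n) →L[ℝ] 𝔼 n) = fderiv ℝ fm.fl (fm.β fm.j₀ + facetFrame fm.β fm.hj (x, 0)) ∧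
    (L₃ : (𝔼 n) →L[ℝ] 𝔼 n) = fderiv ℝ fm.kl (fm.β fm.j₀ + facetFrame fm.β fm.hj (x, 0)) ∧
    (L₄ : (𝔼 n) →L[ℝ] 𝔼 n) = fderiv ℝ fm.ku (fm.β fm.j₀ + facetFrame fm.β fm.hj (x, 0)) ∧
    HasFDerivAt Glow (((facetFrame fm.β fm.hj).symm : (𝔼 n) →L[ℝ] facetDir fm.β fm.i₀ × ℝ).comp
      ((L₄.symm : (𝔼 n) →L[ℝ] 𝔼 n).comp ((L₃ : (𝔼 n) →L[ℝ] 𝔼 n).comp ((L₂.symm : (𝔼 n) →L[ℝ] 𝔼 n).comp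
        ((L₁ : (𝔼 n) →L[ℝ] 𝔼 n).comp (facetFrame fm.β fm.hj : (facetDir fm.β fm.i₀ × ℝ) →L[ℝ] 𝔼 n))))))
      (x, 0)

end FacetModel

/-- **Per-facet chart data** of stage 1 of the sweep at the codimension-one cell `c` with margin
`m`: a facet model and its normal form of margin `m`. [folklore] -/
structure FacetChart (c : S.κ) (m : ℝ) where
  /-- the margin-free model data -/
  fm : S.FacetModel c
  /-- the normal form of margin `m` -/
  nf : fm.NF m

namespace FacetChart

variable {S} {c : S.κ} {m : ℝ} (fc : S.FacetChart c m)

/-! Field abbreviations keeping the flat names. -/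

/-- [folklore] -/ abbrev β := fc.fm.β
/-- [folklore] -/ abbrev i₀ := fc.fm.i₀
/-- [folklore] -/ abbrev j₀ := fc.fm.j₀
/-- [folklore] -/ theorem hj : fc.j₀ ≠ fc.i₀ := fc.fm.hj
/-- [folklore] -/ theorem facet_eq : facet fc.β fc.i₀ = S.simplex c := fc.fm.facet_eq
/-- [folklore] -/ abbrev pu := fc.fm.pu
/-- [folklore] -/ abbrev pl := fc.fm.pl
/-- [folklore] -/ theorem hpu : 0 < fc.β.coord fc.i₀ fc.pu := fc.fm.hpu
/-- [folklore] -/ theorem hpl : fc.β.coord fc.i₀ fc.pl < 0 := fc.fm.hpl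
/-- [folklore] -/ theorem tu_mem : insert fc.pu (S.simplex c) ∈ (S.K (S.owner c)).faces := fc.fm.tu_mem
/-- [folklore] -/ theorem tl_mem : insert fc.pl (S.simplex c) ∈ (S.K (S.owner c)).faces := fc.fm.tl_mem
/-- [folklore] -/ abbrev fu := fc.fm.fu
/-- [folklore] -/ abbrev fl := fc.fm.fl
/-- [folklore] -/ abbrev ku := fc.fm.ku
/-- [folklore] -/ abbrev kl := fc.fm.kl
/-- [folklore] -/ theorem hfu : ContDiff ℝ ∞ fc.fu := fc.fm.hfu
/-- [folklore] -/ theorem hfl : ContDiff ℝ ∞ fc.fl := fc.fm.hfl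
/-- [folklore] -/ theorem hku : ContDiff ℝ ∞ fc.ku := fc.fm.hku
/-- [folklore] -/ theorem hkl : ContDiff ℝ ∞ fc.kl := fc.fm.hkl
/-- [folklore] -/ theorem fu_eq : EqOn (S.e₁ (S.owner c) ∘ (S.φ (S.owner c)).symm) fc.fu
    (convexHull ℝ ((insert fc.pu (S.simplex c) : Finset (𝔼 n)) : Set (𝔼 n))) := fc.fm.fu_eq
/-- [folklore] -/ theorem fl_eq : EqOn (S.e₁ (S.owner c) ∘ (S.φ (S.owner c)).symm) fc.fl
    (convexHull ℝ ((insert fc.pl (S.simplex c) : Finset (𝔼 n)) : Set (𝔼 n))) := fc.fm.fl_eq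
/-- [folklore] -/ theorem ku_eq : EqOn (S.e₂ (S.owner c) ∘ (S.φ (S.owner c)).symm) fc.ku
    (convexHull ℝ ((insert fc.pu (S.simplex c) : Finset (𝔼 n)) : Set (𝔼 n))) := fc.fm.ku_eq
/-- [folklore] -/ theorem kl_eq : EqOn (S.e₂ (S.owner c) ∘ (S.φ (S.owner c)).symm) fc.kl
    (convexHull ℝ ((insert fc.pl (S.simplex c) : Finset (𝔼 n)) : Set (𝔼 n))) := fc.fm.kl_eq
/-- [folklore] -/ theorem hDfu : ∀ x ∈ convexHull ℝ ((insert fc.pu (S.simplex c) : Finset (𝔼 n)) : Set (𝔼 n)),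
    Injective (fderiv ℝ fc.fu x) := fc.fm.hDfu
/-- [folklore] -/ theorem hDfl : ∀ x ∈ convexHull ℝ ((insert fc.pl (S.simplex c) : Finset (𝔼 n)) : Set (𝔼 n)),
    Injective (fderiv ℝ fc.fl x) := fc.fm.hDfl
/-- [folklore] -/ theorem hDku : ∀ x ∈ convexHull ℝ ((insert fc.pu (S.simplex c) : Finset (𝔼 n)) : Set (𝔼 n)),
    Injective (fderiv ℝ fc.ku x) := fc.fm.hDku
/-- [folklore] -/ theorem hDkl : ∀ x ∈ convexHull ℝ ((insert fc.pl (S.simplex c) : Finset (𝔼 n)) : Set (𝔼 n)),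
    Injective (fderiv ℝ fc.kl x) := fc.fm.hDkl
/-- [folklore] -/ abbrev Θ := fc.nf.Θ
/-- [folklore] -/ abbrev Θ' := fc.nf.Θ'
/-- [folklore] -/ abbrev Glow := fc.nf.Glow
/-- [folklore] -/ abbrev δ := fc.nf.δ
/-- [folklore] -/ theorem normalForm : IsCreaseNormalForm fc.Θ fc.Θ' (S.e₂ (S.owner c) ∘ (S.e₁ (S.owner c)).symm)
    fc.Glow (facetCoreOpen fc.β fc.i₀ fc.j₀ m) fc.δ := fc.nf.normalForm
/-- [folklore] -/ theorem hΘ : ContDiffOn ℝ ∞ fc.Θ fc.Θ.source := fc.nf.hΘ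
/-- [folklore] -/ theorem hΘs : ContDiffOn ℝ ∞ fc.Θ.symm fc.Θ.target := fc.nf.hΘs
/-- [folklore] -/ theorem hΘ' : ContDiffOn ℝ ∞ fc.Θ' fc.Θ'.source := fc.nf.hΘ'
/-- [folklore] -/ theorem hΘ's : ContDiffOn ℝ ∞ fc.Θ'.symm fc.Θ'.target := fc.nf.hΘ's
/-- [folklore] -/ theorem Θ_apply : ∀ p, fc.Θ p = fc.fu (fc.β fc.j₀ + facetFrame fc.β fc.hj p) := fc.nf.Θ_apply
/-- [folklore] -/ theorem Θ'_apply : ∀ p, fc.Θ' p = fc.ku (fc.β fc.j₀ + facetFrame fc.β fc.hj p) := fc.nf.Θ'_apply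
/-- [folklore] -/ theorem box_mem : ∀ p : facetDir fc.β fc.i₀ × ℝ, p.1 ∈ facetCore fc.β fc.i₀ fc.j₀ (m / 2) → |p.2| < fc.δ →
    fc.β fc.j₀ + facetFrame fc.β fc.hj p ∈ (S.φ (S.owner c)).target ∩
      (S.φ (S.owner c)).symm ⁻¹' ((S.e₁ (S.owner c)).source ∩ (S.e₂ (S.owner c)).source) ∧
    ∃ q ∈ (S.φ (S.owner c)).target ∩
      (S.φ (S.owner c)).symm ⁻¹' ((S.e₁ (S.owner c)).source ∩ (S.e₂ (S.owner c)).source),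
      (q ∈ convexHull ℝ ((insert fc.pu (S.simplex c) : Finset (𝔼 n)) : Set (𝔼 n)) ∨
        q ∈ convexHull ℝ ((insert fc.pl (S.simplex c) : Finset (𝔼 n)) : Set (𝔼 n))) ∧
      S.e₁ (S.owner c) ((S.φ (S.owner c)).symm q) = fc.fu (fc.β fc.j₀ + facetFrame fc.β fc.hj p) := fc.nf.box_mem
/-- [folklore] -/ theorem upper_mem : ∀ p : facetDir fc.β fc.i₀ × ℝ, p.1 ∈ facetCore fc.β fc.i₀ fc.j₀ (m / 2) → 0 ≤ p.2 → p.2 < fc.δ →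
    fc.β fc.j₀ + facetFrame fc.β fc.hj p ∈ convexHull ℝ ((insert fc.pu (S.simplex c) : Finset (𝔼 n)) : Set (𝔼 n)) :=
  fc.nf.upper_mem
/-- [folklore] -/ theorem box_source : ∀ p : facetDir fc.β fc.i₀ × ℝ, p.1 ∈ facetCore fc.β fc.i₀ fc.j₀ (m / 2) → |p.2| < fc.δ →
    p ∈ fc.Θ.source ∧ p ∈ fc.Θ'.source := fc.nf.box_source
/-- [folklore] -/ theorem glow_face : ∀ x ∈ facetCore fc.β fc.i₀ fc.j₀ (m / 2), ∃ L₁ L₂ L₃ L₄ : (𝔼 n) ≃L[ℝ] 𝔼 n,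
    (L₁ : (𝔼 n) →L[ℝ] 𝔼 n) = fderiv ℝ fc.fu (fc.β fc.j₀ + facetFrame fc.β fc.hj (x, 0)) ∧
    (L₂ : (𝔼 n) →L[ℝ] 𝔼 n) = fderiv ℝ fc.fl (fc.β fc.j₀ + facetFrame fc.β fc.hj (x, 0)) ∧
    (L₃ : (𝔼 n) →L[ℝ] 𝔼 n) = fderiv ℝ fc.kl (fc.β fc.j₀ + facetFrame fc.β fc.hj (x, 0)) ∧
    (L₄ : (𝔼 n) →L[ℝ] 𝔼 n) = fderiv ℝ fc.ku (fc.β fc.j₀ + facetFrame fc.β fc.hj (x, 0)) ∧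
    HasFDerivAt fc.Glow (((facetFrame fc.β fc.hj).symm : (𝔼 n) →L[ℝ] facetDir fc.β fc.i₀ × ℝ).comp
      ((L₄.symm : (𝔼 n) →L[ℝ] 𝔼 n).comp ((L₃ : (𝔼 n) →L[ℝ] 𝔼 n).comp ((L₂.symm : (𝔼 n) →L[ℝ] 𝔼 n).comp
        ((L₁ : (𝔼 n) →L[ℝ] 𝔼 n).comp (facetFrame fc.β fc.hj : (facetDir fc.β fc.i₀ × ℝ) →L[ℝ] 𝔼 n))))))
      (x, 0) := fc.nf.glow_face

end FacetChart

/-- A point with vanishing height and nonnegative facet coordinates lies in the closed facet.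
[folklore] -/
theorem mem_convexHull_facet_of_coord {ι : Type*} [Fintype ι] [DecidableEq ι]
    (b : AffineBasis ι ℝ (𝔼 n)) (i₀ : ι) {x : 𝔼 n} (h0 : b.coord i₀ x = 0)
    (hpos : ∀ i, i ≠ i₀ → 0 ≤ b.coord i x) : x ∈ convexHull ℝ (facet b i₀ : Set (𝔼 n)) := by
  have hsum : ∑ i, b.coord i x = 1 := b.sum_coord_apply_eq_one _
  have hrepr : ∑ i, b.coord i x • b i = x := b.linear_combination_coord_eq_self _
  have hsum' : ∑ i ∈ Finset.univ.erase i₀, b.coord i x = 1 := by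
    rw [← Finset.add_sum_erase _ _ (Finset.mem_univ i₀), h0, zero_add] at hsum; exact hsum
  have hrepr' : ∑ i ∈ Finset.univ.erase i₀, b.coord i x • b i = x := by
    rw [← Finset.add_sum_erase _ _ (Finset.mem_univ i₀), h0, zero_smul, zero_add] at hrepr
    exact hrepr
  rw [← hrepr']
  refine (convex_convexHull ℝ _).sum_mem (fun i hi => hpos i (Finset.ne_of_mem_erase hi)) hsum'
    fun i hi => ?_
  exact subset_convexHull ℝ _
    (Finset.mem_coe.2 (mem_facet_iff.2 ⟨i, Finset.ne_of_mem_erase hi, rfl⟩))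

/-- **The facet model exists** for `n ≥ 1` and every codimension-one cell.
[cite: Munkres1960, §2] -/
theorem nonempty_facetModel (hn : 1 ≤ n) (c : S.κ) (hc : (S.simplex c).card = n) :
    Nonempty (S.FacetModel c) := by
  classical
  set i := S.owner c with hi_def
  set K := S.K i with hK_def
  set s := S.simplex c with hs_def
  have hsK : s ∈ K.faces := S.simplex_mem c
  have hfin : Module.finrank ℝ (𝔼 n) = n := finrank_euclideanSpace_fin
  -- ### the affine basis and the apex index
  obtain ⟨β, hβ⟩ := exists_affineBasis_superset (K.indep hsK)
  have hβinj : Injective β := β.ind.injective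
  obtain ⟨i₀, hi₀⟩ : ∃ i₀, β i₀ ∉ s := by
    by_contra hall
    simp only [not_exists, not_not] at hall
    have hsub : Finset.univ.image β ⊆ s := by
      intro x hx
      obtain ⟨j, -, rfl⟩ := Finset.mem_image.1 hx
      exact hall j
    have h1 : (Finset.univ.image β).card = Module.finrank ℝ (𝔼 n) + 1 := by
      rw [Finset.card_image_of_injective _ hβinj, Finset.card_univ, Fintype.card_fin]
    have h2 := Finset.card_le_card hsub
    rw [h1, hc, hfin] at h2
    omega
  have hfacet : facet β i₀ = s := by
    symm
    apply Finset.eq_of_subset_of_card_le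
    · intro x hx
      obtain ⟨j, hj⟩ := hβ (Finset.mem_coe.2 hx)
      refine mem_facet_iff.2 ⟨j, fun h => hi₀ ?_, hj⟩
      rw [← h, hj]; exact hx
    · have : (facet β i₀).card ≤ (Finset.univ.filter fun j => j ≠ i₀).card :=
        Finset.card_image_le
      rw [Finset.filter_ne' Finset.univ i₀, Finset.card_erase_of_mem (Finset.mem_univ _),
        Finset.card_univ, Fintype.card_fin] at this
      rw [hc]; omega
  -- a base index
  obtain ⟨j₀, hj₀⟩ : ∃ j₀ : FIdx n, j₀ ≠ i₀ := by
    have hsne : s.Nonempty := Finset.card_pos.1 (by rw [hc]; exact hn)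
    obtain ⟨x, hx⟩ := hsne
    obtain ⟨j, hj⟩ := hβ (Finset.mem_coe.2 hx)
    exact ⟨j, fun h => hi₀ (by rw [← h, hj]; exact hx)⟩
  -- ### the centroid of the facet and the two cofaces
  set T : Finset (FIdx n) := Finset.univ.filter fun j => j ≠ i₀ with hT
  have hTne : T.Nonempty := ⟨j₀, Finset.mem_filter.2 ⟨Finset.mem_univ _, hj₀⟩⟩
  set x₀ : 𝔼 n := T.centroid ℝ β with hx₀
  have hw1 : T.sum (T.centroidWeights ℝ) = 1 := T.sum_centroidWeights_eq_one_of_nonempty ℝ hTne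
  have hx₀0 : β.coord i₀ x₀ = 0 := by
    rw [hx₀, Finset.centroid_def]
    exact β.coord_apply_combination_of_notMem (by simp [hT]) hw1
  have hx₀pos : ∀ j, j ≠ i₀ → 0 < β.coord j x₀ := fun j hj => by
    have hjT : j ∈ T := Finset.mem_filter.2 ⟨Finset.mem_univ _, hj⟩
    rw [hx₀, β.coord_apply_centroid (s := T) (i := j) hjT]
    exact inv_pos.2 (Nat.cast_pos.2 (Finset.card_pos.2 hTne))
  have hx₀s : x₀ ∈ convexHull ℝ (facet β i₀ : Set (𝔼 n)) :=
    mem_convexHull_facet_of_coord β i₀ hx₀0 fun j hj => (hx₀pos j hj).le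
  have hnhds : K.space ∈ 𝓝 x₀ := by
    refine mem_of_superset (isOpen_interior.mem_nhds (S.interior_owned c ?_)) interior_subset
    rw [← hs_def, ← hfacet]; exact hx₀s
  have hfacetK : facet β i₀ ∈ K.faces := by rw [hfacet]; exact hsK
  obtain ⟨pu, hpuK, hpu⟩ := exists_coface_of_sign (S.finite i) β i₀ hfacetK hx₀s hx₀pos hnhds
    (σ := 1) (Or.inl rfl)
  obtain ⟨pl, hplK, hpl⟩ := exists_coface_of_sign (S.finite i) β i₀ hfacetK hx₀s hx₀pos hnhds
    (σ := -1) (Or.inr rfl)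
  rw [one_mul] at hpu
  have hpl' : β.coord i₀ pl < 0 := by linarith
  rw [hfacet] at hpuK hplK
  -- the cofaces are top simplices
  have hpus : pu ∉ s := fun h => by
    have := coord_eq_zero_of_mem_facet (b := β) (i₀ := i₀) (by rw [hfacet]; exact h)
    linarith
  have hpls : pl ∉ s := fun h => by
    have := coord_eq_zero_of_mem_facet (b := β) (i₀ := i₀) (by rw [hfacet]; exact h)
    linarith
  have hcu : (insert pu s).card = n + 1 := by rw [Finset.card_insert_of_notMem hpus, hc]
  have hcl : (insert pl s).card = n + 1 := by rw [Finset.card_insert_of_notMem hpls, hc]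
  obtain ⟨fu, hfu, hfu_eq, hDfu⟩ := S.model₁ i _ hpuK hcu
  obtain ⟨fl, hfl, hfl_eq, hDfl⟩ := S.model₁ i _ hplK hcl
  obtain ⟨ku, hku, hku_eq, hDku⟩ := S.model₂ i _ hpuK hcu
  obtain ⟨kl, hkl, hkl_eq, hDkl⟩ := S.model₂ i _ hplK hcl
  exact ⟨{ β := β, i₀ := i₀, j₀ := j₀, hj := hj₀, facet_eq := hfacet, pu := pu, pl := pl,
           hpu := hpu, hpl := hpl', tu_mem := hpuK, tl_mem := hplK,
           fu := fu, fl := fl, ku := ku, kl := kl, hfu := hfu, hfl := hfl, hku := hku, hkl := hkl,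
           fu_eq := hfu_eq, fl_eq := hfl_eq, ku_eq := hku_eq, kl_eq := hkl_eq,
           hDfu := hDfu, hDfl := hDfl, hDku := hDku, hDkl := hDkl }⟩

/-- A chosen facet model. [folklore] -/
def facetModel (hn : 1 ≤ n) (c : S.κ) (hc : (S.simplex c).card = n) : S.FacetModel c :=
  Classical.choice (S.nonempty_facetModel hn c hc)

variable {S} in
/-- **The normal form of margin `m` exists** on every facet model. [cite: Munkres1960, §2–§3] -/
theorem FacetModel.nonempty_nf {c : S.κ} (fm : S.FacetModel c) {m : ℝ} (hm : 0 < m) :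
    Nonempty (fm.NF m) := by
  classical
  set i := S.owner c with hi_def
  set K := S.K i with hK_def
  set s := S.simplex c with hs_def
  have hsK : s ∈ K.faces := S.simplex_mem c
  set β := fm.β
  set i₀ := fm.i₀
  set j₀ := fm.j₀
  have hj₀ : j₀ ≠ i₀ := fm.hj
  have hfacet : facet β i₀ = s := fm.facet_eq
  set pu := fm.pu
  set pl := fm.pl
  have hpu : 0 < β.coord i₀ pu := fm.hpu
  have hpl' : β.coord i₀ pl < 0 := fm.hpl
  set fu := fm.fu
  set fl := fm.fl
  set ku := fm.ku
  set kl := fm.kl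
  have hfu : ContDiff ℝ ∞ fu := fm.hfu
  have hfl : ContDiff ℝ ∞ fl := fm.hfl
  have hku : ContDiff ℝ ∞ ku := fm.hku
  have hkl : ContDiff ℝ ∞ kl := fm.hkl
  have hfu_eq := fm.fu_eq
  have hfl_eq := fm.fl_eq
  have hku_eq := fm.ku_eq
  have hkl_eq := fm.kl_eq
  have hDfu := fm.hDfu
  have hDfl := fm.hDfl
  have hDku := fm.hDku
  have hDkl := fm.hDkl
  -- ### the frame, the cores, the PD maps
  set Alin := facetFrame β hj₀ with hAlin
  have hA : ∀ p : facetDir β i₀ × ℝ, β.coord i₀ (β j₀ + Alin p) = 1 * p.2 := fun p => by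
    rw [one_mul]; exact coord_facetFrame β hj₀ p
  set V : Set (facetDir β i₀) := facetCoreOpen β i₀ j₀ m with hV
  set KV : Set (facetDir β i₀) := facetCore β i₀ j₀ (m / 2) with hKV
  have hVo : IsOpen V := isOpen_facetCoreOpen β i₀ j₀ m
  have hKVc : IsCompact KV := isCompact_facetCore β hj₀ (by positivity)
  have hVK : V ⊆ KV := facetCoreOpen_subset_facetCore β i₀ j₀ (by linarith)
  have hA0 : ∀ x : facetDir β i₀, β j₀ + Alin (x, 0) = β j₀ + (x : 𝔼 n) := fun x => by
    simp [hAlin]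
  have hmargin : ∀ x ∈ KV, ∀ j, j ≠ i₀ → m / 2 ≤ β.coord j (β j₀ + Alin (x, 0)) :=
    fun x hx j hj => by rw [hA0]; exact hx j hj
  -- the PD maps
  set φ := S.φ i with hφ
  set e₁ := S.e₁ i with he₁
  set e₂ := S.e₂ i with he₂
  set O : Set (𝔼 n) := φ.target ∩ φ.symm ⁻¹' (e₁.source ∩ e₂.source) with hO
  have hOo : IsOpen O := φ.continuousOn_symm.isOpen_inter_preimage φ.open_target
    (e₁.open_source.inter e₂.open_source)
  set f : 𝔼 n → 𝔼 n := e₁ ∘ φ.symm with hf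
  set h : 𝔼 n → 𝔼 n := e₂ ∘ φ.symm with hh
  set u : 𝔼 n → 𝔼 n := e₂ ∘ e₁.symm with hu
  -- core points are in `O`
  have hcoreO : ∀ x ∈ KV, β j₀ + Alin (x, 0) ∈ O := by
    intro x hx
    rw [hA0]
    have hmem := (mem_convexHull_facet_of_mem_facetCore β hj₀ (by positivity) hx).2
    rw [hfacet] at hmem
    have hsp : β j₀ + (x : 𝔼 n) ∈ K.space := K.convexHull_subset_space hsK hmem
    refine ⟨S.space_subset i hsp, ?_⟩
    show φ.symm (β j₀ + (x : 𝔼 n)) ∈ e₁.source ∩ e₂.source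
    exact ⟨S.source₁ i ⟨_, hsp, rfl⟩, S.source₂ i ⟨_, hsp, rfl⟩⟩
  have hfc : ContinuousOn f O :=
    e₁.continuousOn.comp (φ.continuousOn_symm.mono inter_subset_left) fun x hx => hx.2.1
  have hhc : ContinuousOn h O :=
    e₂.continuousOn.comp (φ.continuousOn_symm.mono inter_subset_left) fun x hx => hx.2.2
  have hfinj : InjOn f O := by
    intro x hx y hy hxy
    have h1 : φ.symm x = φ.symm y := e₁.injOn hx.2.1 hy.2.1 hxy
    exact φ.symm.injOn hx.1 hy.1 h1
  have hhinj : InjOn h O := by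
    intro x hx y hy hxy
    have h1 : φ.symm x = φ.symm y := e₂.injOn hx.2.2 hy.2.2 hxy
    exact φ.symm.injOn hx.1 hy.1 h1
  have hfopen : ∀ N : Set (𝔼 n), IsOpen N → N ⊆ O → IsOpen (f '' N) := by
    intro N hN hNO
    have h1 : IsOpen (φ.symm '' N) :=
      φ.symm.isOpen_image_of_subset_source hN fun x hx => (hNO hx).1
    have h2 : φ.symm '' N ⊆ e₁.source := by
      rintro _ ⟨x, hx, rfl⟩; exact (hNO hx).2.1
    have : f '' N = e₁ '' (φ.symm '' N) := by rw [hf, image_comp]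
    rw [this]
    exact e₁.isOpen_image_of_subset_source h1 h2
  have huf : ∀ x ∈ O, u (f x) = h x := fun x hx => by
    simp only [hu, hf, hh, comp_apply]
    rw [e₁.left_inv hx.2.1]
  -- ### the normal form (hypotheses restated with `facet β i₀` in place of `s`)
  have hDfu' : ∀ x ∈ convexHull ℝ ((insert pu (facet β i₀) : Finset (𝔼 n)) : Set (𝔼 n)),
      Injective (fderiv ℝ fu x) := by rw [hfacet]; exact hDfu
  have hDfl' : ∀ x ∈ convexHull ℝ ((insert pl (facet β i₀) : Finset (𝔼 n)) : Set (𝔼 n)),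
      Injective (fderiv ℝ fl x) := by rw [hfacet]; exact hDfl
  have hDku' : ∀ x ∈ convexHull ℝ ((insert pu (facet β i₀) : Finset (𝔼 n)) : Set (𝔼 n)),
      Injective (fderiv ℝ ku x) := by rw [hfacet]; exact hDku
  have hDkl' : ∀ x ∈ convexHull ℝ ((insert pl (facet β i₀) : Finset (𝔼 n)) : Set (𝔼 n)),
      Injective (fderiv ℝ kl x) := by rw [hfacet]; exact hDkl
  have hffu : ∀ x ∈ O, x ∈ convexHull ℝ ((insert pu (facet β i₀) : Finset (𝔼 n)) : Set (𝔼 n)) →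
      f x = fu x := by rw [hfacet]; exact fun x _ hx => hfu_eq hx
  have hffl : ∀ x ∈ O, x ∈ convexHull ℝ ((insert pl (facet β i₀) : Finset (𝔼 n)) : Set (𝔼 n)) →
      f x = fl x := by rw [hfacet]; exact fun x _ hx => hfl_eq hx
  have hhku : ∀ x ∈ O, x ∈ convexHull ℝ ((insert pu (facet β i₀) : Finset (𝔼 n)) : Set (𝔼 n)) →
      h x = ku x := by rw [hfacet]; exact fun x _ hx => hku_eq hx
  have hhkl : ∀ x ∈ O, x ∈ convexHull ℝ ((insert pl (facet β i₀) : Finset (𝔼 n)) : Set (𝔼 n)) →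
      h x = kl x := by rw [hfacet]; exact fun x _ hx => hkl_eq hx
  obtain ⟨Θ, Θ', Glow, δ, hNF, hΘ, hΘs, hΘ', hΘ's, hΘapply, hΘ'apply, hbox, hupper, hsrc, hface⟩ :=
    exists_creaseNormalForm β i₀ hpu hpl' Alin (β j₀) one_pos hA hVo hKVc hVK (half_pos hm)
      hmargin hfu hfl hku hkl hDfu' hDfl' hDku' hDkl' hOo hcoreO hfc hhc hfinj hhinj hfopen
      hffu hffl hhku hhkl huf
  exact ⟨{ Θ := Θ, Θ' := Θ', Glow := Glow, δ := δ, normalForm := hNF,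
           hΘ := hΘ, hΘs := hΘs, hΘ' := hΘ', hΘ's := hΘ's,
           Θ_apply := hΘapply, Θ'_apply := hΘ'apply,
           box_mem := by rw [← hs_def, ← hfacet]; exact hbox,
           upper_mem := by rw [← hs_def, ← hfacet]; exact hupper,
           box_source := hsrc, glow_face := hface }⟩

variable {S} in
/-- A chosen normal form of margin `m`. [folklore] -/
def FacetModel.nf' {c : S.κ} (fm : S.FacetModel c) {m : ℝ} (hm : 0 < m) : fm.NF m :=
  Classical.choice (fm.nonempty_nf hm)

/-- **Stage 1 per cell: the facet chart** for `n ≥ 1`, every codimension-one cell and every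
margin `m > 0`, built on the CHOSEN (margin-free) facet model. [cite: Munkres1960, §2–§3] -/
def facetChart (hn : 1 ≤ n) (c : S.κ) (hc : (S.simplex c).card = n) {m : ℝ} (hm : 0 < m) :
    S.FacetChart c m :=
  ⟨S.facetModel hn c hc, (S.facetModel hn c hc).nf' hm⟩

/-- The facet chart's model is the chosen facet model (definitional). [folklore] -/
theorem facetChart_fm (hn : 1 ≤ n) (c : S.κ) (hc : (S.simplex c).card = n) {m : ℝ} (hm : 0 < m) :
    (S.facetChart hn c hc hm).fm = S.facetModel hn c hc := rfl

/-- For compatibility: the facet chart type is inhabited. [folklore] -/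
theorem nonempty_facetChart (hn : 1 ≤ n) (c : S.κ) (hc : (S.simplex c).card = n) {m : ℝ}
    (hm : 0 < m) : Nonempty (S.FacetChart c m) := ⟨S.facetChart hn c hc hm⟩



end SweepData

end Literature.Topology.FourManifolds
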